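import Summits.BirchSwinnertonDyer.Rank1Residual.P2.CongruentNumberSilentEvenFiveEnclosureDescent
import Summits.BirchSwinnertonDyer.Rank1Residual.P2.CongruentNumberEvenFiveThreeModEightMonskyDescent
import HarnessLib

/-!
# Cell `bsd-monsky`, route A's reach on the even-five family `2p₅q₃`: `ord_{s=1} L(E_{2pq}, s) = 1 ∧ BSD(E_{2pq}, 2)`
# on the COMPLEMENT of `(15)⁺ = {q ≡ 7 (8), (p/q) = +1}` from Tian's CM-point system sentences alone, and on the whole
# family with {TYZ data, GZK} used on `(15)⁺` ONLY

HONEST FRAMING (cell `bsd-monsky`, run/shared/lean/pub/bsd-monsky/; README §1): ONE theorem on ONE explicit infinite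
family at the prime `2`; nothing booked; every conclusion CONDITIONAL on the displayed sentences named in its binders.
Bookkeeping of where each input is used on the family `{p ≡ 5 (8), q ≡ 3 (4)}` = `(13)⁻ ∪ (13)⁺ ∪ (15)⁻ ∪ (15)⁺`
(Monsky's numbering, Thm. 5.14, p. 66; `(13) = {q ≡ 3 (8)}`, `(15) = {q ≡ 7 (8)}`, `±` the sign of `(p/q)`):
* `𝒮⁻ = (13)⁻ ∪ (15)⁻`: the landed corner `congruentSilentEvenFiveBSDTwo_of_genusSystem_descent (hSys′)` — the system display
  `tian2014_system_sMinus_genus` ALONE (2-Selmer in the kernel);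
* `(13)⁺`: `…ThreeModEightMonskyDescent.lean` — the same system sentences on `{q ≡ 3 (8)}` ALONE (Monsky Thm. 5.5 without
  proviso; no GZK, no TYZ genus theorem);
* `(15)⁺`: `analyticRank_eq_one_and_bsdp_two_plus_descent (hTYZ) (hGZK)` — TYZ's genus criterion and the Gross–Zagier–Kolyvagin
  binder; route A as printed does not reach it (Monsky p. 64 uses Lemma 5.6, real-locus positions not in Tian's skeleton).
So: GZK and TYZ Thm. 1.2 enter the whole-family statement through `(15)⁺` ONLY. Nothing asserted.
[cite: Monsky1990MockHeegner, Thm. 5.5 (p. 62), Thm. 5.9 (1) (pp. 63–64), Thm. 5.14 (13)/(15) (p. 66)]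
[cite: Tian2014, Thm. 2.8 (J132), Notations (J122–123)] [cite: TianYuanZhang2017, Thm. 1.2, Thm. 3.3]
[cite: Miller2011LMS, Def. 1.1 (arXiv:1010.2431 p. 3)]
-/

noncomputable section

open scoped Classical

open WeierstrassCurve Literature.NumberTheory.EllipticCurves
  Literature.NumberTheory.EllipticCurves.Rank1Residual.Typed
  Literature.NumberTheory.EllipticCurves.TianYuanZhang2017

set_option autoImplicit false

namespace Summit.BirchSwinnertonDyer.Rank1Residual.P2

open Conjectures Literature.NumberTheory.EllipticCurves.Tian2014

/-- **Route A's reach: `ord = 1 ∧ BSD₂` on the even-five family OUTSIDE `(15)⁺`** — for primes `p ≡ 5 (8)`, `q ≡ 3 (4)` with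
`q ≡ 3 (8)` or `(p/q) = −1`, from the system display on `𝒮⁻` (`hSys′`) and the system sentences on `{q ≡ 3 (8)}` (the binder
`h13`) — no GZK, no TYZ genus theorem, no `2`-Selmer display. CONDITIONAL; nothing asserted.
[cite: Monsky1990MockHeegner, Thm. 5.5 (p. 62), Thm. 5.9 (1) (pp. 63–64), Thm. 5.14 (13)/(15) (p. 66)]
[cite: Tian2014, Thm. 2.8 (J132)] [cite: TianYuanZhang2017, Thm. 3.3] [cite: Miller2011LMS, Def. 1.1 (arXiv:1010.2431 p. 3)] -/
theorem analyticRank_eq_one_and_bsdp_two_of_routeA (hSys : tian2014_system_sMinus_genus)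
    (h13 : ∀ p q : ℕ, (hp : p.Prime) → (hq : q.Prime) → p % 8 = 5 → q % 8 = 3 →
      ∃ D : CMPointData (p * q), D.Printed ∧
        D.GrossZagierScriptL (Nat.mul_ne_zero hp.ne_zero hq.ne_zero) ∧ D.GenusTheoryDisplays)
    {p q : ℕ} (hp : p.Prime) (hq : q.Prime) (hp5 : p % 8 = 5) (hq4 : q % 4 = 3)
    (h : q % 8 = 3 ∨ jacobiSym p q = -1) :
    (congruentNumberCurve (2 * (p * q))).analyticRank = 1 ∧ BSDp (congruentNumberCurve (2 * (p * q))) 2 := by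
  rcases h with hq3 | hj
  · exact analyticRank_eq_one_and_bsdp_two_three_mod_eight_of_system h13 hp hq hp5 hq3
  · exact congruentSilentEvenFiveBSDTwo_of_genusSystem_descent hSys p q hp hq hp5 hq4 hj

/-- **The whole even-five family, with {TYZ data, GZK} used on `(15)⁺` ONLY**: for ALL primes `p ≡ 5 (8)`, `q ≡ 3 (4)`,
`ord_{s=1} L(E_{2pq}, s) = 1 ∧ BSD(E_{2pq}, 2)` from `hSys′`, the `(13)` sentences, `hTYZ` and `hGZK` — the last two
entering through the single quarter `{q ≡ 7 (8), (p/q) = +1}`. CONDITIONAL; nothing asserted.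
[cite: Monsky1990MockHeegner, Thm. 5.14 (13)/(15) (p. 66)] [cite: TianYuanZhang2017, Thm. 1.2, Thm. 3.3]
[cite: Miller2011LMS, Def. 1.1 (arXiv:1010.2431 p. 3)] -/
theorem analyticRank_eq_one_and_bsdp_two_evenFive_of_routeA (hSys : tian2014_system_sMinus_genus)
    (h13 : ∀ p q : ℕ, (hp : p.Prime) → (hq : q.Prime) → p % 8 = 5 → q % 8 = 3 →
      ∃ D : CMPointData (p * q), D.Printed ∧
        D.GrossZagierScriptL (Nat.mul_ne_zero hp.ne_zero hq.ne_zero) ∧ D.GenusTheoryDisplays)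
    (hTYZ : tyz_genusPointData) (hGZK : rank_eq_analyticRank_of_analyticRank_le_one) :
    ∀ p q : ℕ, p.Prime → q.Prime → p % 8 = 5 → q % 4 = 3 →
      (congruentNumberCurve (2 * (p * q))).analyticRank = 1 ∧ BSDp (congruentNumberCurve (2 * (p * q))) 2 := by
  intro p q hp hq hp5 hq4
  by_cases h : q % 8 = 3 ∨ jacobiSym p q = -1
  · exact analyticRank_eq_one_and_bsdp_two_of_routeA hSys h13 hp hq hp5 hq4 h
  · have hne : p ≠ q := fun e => by omega
    have hg : (p : ℤ).gcd q = 1 := by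
      rw [Int.gcd_natCast_natCast]; exact (Nat.coprime_primes hp hq).mpr hne
    have hj : jacobiSym p q = 1 := by
      rcases jacobiSym.eq_one_or_neg_one hg with h1 | h1
      · exact h1
      · exact absurd (Or.inr h1) h
    exact analyticRank_eq_one_and_bsdp_two_plus_descent hTYZ hGZK hp hq hp5 hq4 hj

/-- **`BSD(E_{2pq}, 2)` on the whole even-five family in the shape of the landed door
`forall_bsdp_two_congruentNumberCurve_two_mul_five_mul`**, from route A's inputs (+ {TYZ data, GZK} on `(15)⁺` only).
CONDITIONAL; nothing asserted. [cite: Monsky1990MockHeegner, Thm. 5.14 (13)/(15) (p. 66)] [cite: Miller2011LMS, Def. 1.1] -/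
theorem forall_bsdp_two_congruentNumberCurve_two_mul_five_mul_of_routeA (hSys : tian2014_system_sMinus_genus)
    (h13 : ∀ p q : ℕ, (hp : p.Prime) → (hq : q.Prime) → p % 8 = 5 → q % 8 = 3 →
      ∃ D : CMPointData (p * q), D.Printed ∧
        D.GrossZagierScriptL (Nat.mul_ne_zero hp.ne_zero hq.ne_zero) ∧ D.GenusTheoryDisplays)
    (hTYZ : tyz_genusPointData) (hGZK : rank_eq_analyticRank_of_analyticRank_le_one) :
    ∀ p q : ℕ, p.Prime → q.Prime → p % 8 = 5 → q % 4 = 3 →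
      BSDp (congruentNumberCurve (2 * (p * q))) 2 :=
  fun p q hp hq hp5 hq4 => (analyticRank_eq_one_and_bsdp_two_evenFive_of_routeA hSys h13 hTYZ hGZK p q hp hq hp5 hq4).2

end Summit.BirchSwinnertonDyer.Rank1Residual.P2

end
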